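import Mathlib
import HarnessLib
import Literature.MathematicalPhysics.QuantumLattice.HubbardFreeCovariance

/-!
# All derivatives of the Salmhofer ultraviolet cutoff profile are bounded

Topic `MathematicalPhysics/QuantumLattice`; continues `HubbardFreeCovariance` (`salmhoferCutoff x = smoothTransition ((4x−1)/3)`:
`= 0` for `x ≤ 1/4`, `= 1` for `x ≥ 1`, smooth, values in `[0,1]`).  The telescoped space-moment bounds of the ultraviolet covariance
(`HubbardUVBandPieces`, hypotheses `hB : ∀ i ≤ N, ∀ t, ‖iteratedDeriv i salmhoferCutoff t‖ ≤ B`) need a UNIFORM bound of the first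
`N` derivatives; as for any smooth profile constant off a compact interval, continuity on `[1/4, 1]` gives one
(Benfatto–Giuliani–Mastropietro 2006, §2.2 (2.9): "a smooth compact-support cutoff"; the same argument as for the infrared profile
`bgmCutoffSqUnit` in `ScaleZeroMultiplierJoint`):

* `iteratedDeriv_salmhoferCutoff_eq_zero` — positive-order derivatives vanish off `[1/4, 1]`;
* **`exists_norm_iteratedDeriv_salmhoferCutoff_le`** — `∀ N, ∃ B ≥ 1, ∀ i ≤ N, ∀ t, ‖salmhoferCutoff^{(i)}(t)‖ ≤ B`.

Everything is proved; no definitions, no named facts.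

## Sources

G. Benfatto, A. Giuliani, V. Mastropietro, Ann. Henri Poincaré 7 (2006) 809–898, §2.2 (2.9) (`BenfattoGiulianiMastropietro2006`);
M. Salmhofer, Comm. Math. Phys. 194 (1998) 249–295, §2 (`Salmhofer1998`).
-/

noncomputable section

namespace Literature.MathematicalPhysics.QuantumLattice

open Set Filter
open scoped Topology

/-- The derivatives of positive order of the profile vanish off the transition interval `[1/4, 1]`.
[cite: BenfattoGiulianiMastropietro2006, §2.2 (2.9)] -/
theorem iteratedDeriv_salmhoferCutoff_eq_zero {m : ℕ} (hm : 1 ≤ m) {u : ℝ} (hu : u < 1 / 4 ∨ 1 < u) :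
    iteratedDeriv m salmhoferCutoff u = 0 := by
  rcases hu with hu | hu
  · have hev : salmhoferCutoff =ᶠ[𝓝 u] fun _ => (0 : ℝ) := by
      filter_upwards [Iio_mem_nhds hu] with v hv using salmhoferCutoff_of_le (le_of_lt hv)
    rw [hev.iteratedDeriv_eq, iteratedDeriv_const]
    simp
  · have hev : salmhoferCutoff =ᶠ[𝓝 u] fun _ => (1 : ℝ) := by
      filter_upwards [Ioi_mem_nhds hu] with v hv using salmhoferCutoff_of_ge (le_of_lt hv)
    rw [hev.iteratedDeriv_eq, iteratedDeriv_const]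
    simp [show m ≠ 0 by omega]

/-- **All derivatives of the Salmhofer profile are bounded**: for every `N` there is `B ≥ 1` with `‖salmhoferCutoff^{(i)}(t)‖ ≤ B` for all
`i ≤ N` and all `t`. [cite: BenfattoGiulianiMastropietro2006, §2.2 (2.9)] -/
theorem exists_norm_iteratedDeriv_salmhoferCutoff_le (N : ℕ) :
    ∃ B : ℝ, 1 ≤ B ∧ ∀ i ≤ N, ∀ t : ℝ, ‖iteratedDeriv i salmhoferCutoff t‖ ≤ B := by
  have hbd : ∀ m : ℕ, 1 ≤ m → ∃ C : ℝ, 0 ≤ C ∧ ∀ u, ‖iteratedDeriv m salmhoferCutoff u‖ ≤ C := by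
    intro m hm
    have hcont : Continuous (iteratedDeriv m salmhoferCutoff) :=
      (contDiff_salmhoferCutoff (n := m)).continuous_iteratedDeriv' m
    obtain ⟨C, hC⟩ := (isCompact_Icc (a := (1 : ℝ) / 4) (b := 1)).exists_bound_of_continuousOn hcont.continuousOn
    refine ⟨max C 0, le_max_right _ _, fun u => ?_⟩
    by_cases hu : u ∈ Icc ((1 : ℝ) / 4) 1
    · exact (hC u hu).trans (le_max_left _ _)
    · rw [mem_Icc, not_and_or, not_le, not_le] at hu
      rw [iteratedDeriv_salmhoferCutoff_eq_zero hm hu, norm_zero]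
      exact le_max_right _ _
  induction N with
  | zero =>
    refine ⟨1, le_rfl, fun i hi u => ?_⟩
    rw [Nat.le_zero.1 hi, iteratedDeriv_zero, Real.norm_eq_abs]
    have h := salmhoferCutoff_mem_Icc u
    rw [abs_of_nonneg h.1]
    exact h.2
  | succ N ih =>
    obtain ⟨B, hB1, hB⟩ := ih
    obtain ⟨C, hC0, hC⟩ := hbd (N + 1) (Nat.succ_pos N)
    refine ⟨max B C, le_max_of_le_left hB1, fun i hi u => ?_⟩
    rcases Nat.lt_or_ge i (N + 1) with h | h
    · exact (hB i (Nat.lt_succ_iff.1 h) u).trans (le_max_left _ _)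
    · rw [le_antisymm hi h]
      exact (hC u).trans (le_max_right _ _)

end Literature.MathematicalPhysics.QuantumLattice

end
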